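import Literature.AlgebraicGeometry.AbelianSchemes.PoincareBaseQuotientDescent
import Literature.AlgebraicGeometry.AbelianSchemes.PoincareBaseQuotientDescentPicZero
import Literature.AlgebraicGeometry.AbelianSchemes.DualPairBaseQuotientDescentUnique
import Literature.AlgebraicGeometry.AbelianSchemes.RigidifiedTrivialFpqcDescent
import Literature.AlgebraicGeometry.RelativeSpec.GeometricQuotientFreeBaseChange
import Literature.AlgebraicGeometry.RelativeSpec.GeometricQuotientFreeFlat
import Literature.AlgebraicGeometry.RelativeSpec.ActionOverPullback
import HarnessLib

/-!
# The dual pair descends along a free finite quotient OF THE BASE: universality over `Q`, and the assembly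
# ([MFK94] Ch. 7 §3 remark after Thm. 7.9, Lemma 7.11; [Mumford AV] §13 p. 125; [Milne AV] I §8; SGA 1 VIII 7.8)

Topic `AlgebraicGeometry/AbelianSchemes`; namespace `Literature.AlgebraicGeometry.AbelianSchemes.AbelianSchemeOver`.
THEOREMS ONLY (no definition, no named fact, no instance, no notation, no `sorry`; net Literature debt 0).
Cell hodgecm-mathlib (D-0151), F-DAG price sheet leaf F-10 (10a) «the universal triple DESCENDS along the free finite
quotient of the base `M → M/Γ`», the DUAL-PAIR instalment, part 4 = the LAST: after ★ `PoincareBaseQuotientDescent`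
(a rigidified line bundle `𝒫_B` on `B ×_Q B̂` with `(π ×_p π̂)^*𝒫_B ≅ 𝒫`), ★ `PoincareBaseQuotientDescentPicZero` (it is
fibrewise in `Pic⁰`) and ★ `DualPairBaseQuotientDescentUnique` (uniqueness of classifying morphisms over `Q`), this
file proves the EXISTENCE half of the universal property of `(B̂, 𝒫_B)` over `Q` and assembles the four property fields
of ★ `DualPair` for `(B̂, 𝒫_B)` together with the Poincaré clause `(π ×_p π̂)^*𝒫_B ≅ 𝒫` along `(π, π̂, p)`.  With ★
`AbelianSchemeBaseQuotientDescent` / `…HomDescent` / `LevelStructureBaseQuotientDescent` /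
`PolarizationBaseQuotientDescent` this completes «the universal triple `(A, Â, 𝒫, λ, level)` descends along
`M → M/Γ`» up to the (formal) transport junction.  HC_CM is proved only modulo the 7 printed citations until rung 0
closes; this file discharges none of them (count-neutral capital).

SETTING (as in ★ `PoincareBaseQuotientDescent`).  `p : S → Q` an AFFINE geometric quotient of `S` by a FREE action
`ρ` of the finite group `G`; `A/S` with a dual pair `D = (Â, 𝒫)`; `B`, `B̂` abelian schemes over `Q` and `π : A → B`,
`π̂ : Â → B̂` exhibiting `A`, `Â` as the base changes of `B`, `B̂` along `p` as group schemes (`hAB`, `hÂB̂`); actions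
`ρA`, `ρÂ` of `G` on `A`, `Â` over `π`, `π̂` covering `ρ` by isomorphisms of group schemes (`hA`, `hÂ`); the Poincaré
clause `hP : ∀ g, (ρA(g) ×_{ρ(g)} ρÂ(g))^*𝒫 ≅ 𝒫`; a module `P′` on `B ×_Q B̂` with `ϖ^*P′ ≅ 𝒫`, `ϖ = π ×_p π̂`.

PROOF OF EXISTENCE ([MumfordAV1970] §13's construction, run on the finite étale cover `T ×_Q S → T`).  Given
`f : T → Q` and a rigidified fibrewise-`Pic⁰` line bundle `ℒ` on `B_T`: put `T′ := S ×_Q T` (projections `f′`, `c`).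
(§1) `A ×_S T′ ≅ B ×_Q T′` over `T′` as group schemes (★ `exists_iso_baseChange_prodMap`), so `κ^*ℒ` (`κ = π ×_p c`)
is a rigidified fibrewise-`Pic⁰` family `ℒ″` on `A ×_S T′`.  (§2) Its classifying map `g′ : T′ → Â` is `G`-EQUIVARIANT:
for the base-changed action `σ = ρ(γ) × 1` on `T′`, both `σ ≫ g′` and `g′ ≫ ρÂ(γ)` classify `(1_A × σ)^*ℒ″` over
`f′ ≫ ρ(γ)` — the second because `1_A × (g′ ≫ ρÂ(γ)) = (ρA(γ)⁻¹ × 1) ≫ (1_A × g′) ≫ (ρA(γ) × ρÂ(γ))` and the Poincaré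
clause — hence they agree (★ `DualPair.eq_of_nonempty_iso`).  (§3) So `g′ ≫ π̂` is invariant and DESCENDS along the
geometric quotient `c : T′ → T` (★ `existsUnique_desc_baseChange_of_free`) to `g : T → B̂` over `f`; and
`(1_B × g)^*P′ ≅ ℒ` holds after `κ^*` (both become `(1_A × g′)^*𝒫 ≅ ℒ″`, ★ `DualPairBaseQuotientDescentUnique` §1),
i.e. after `(1_B × c)^*`, hence on `B_T` by fpqc descent of isomorphisms of RIGIDIFIED line bundles (★
`RigidifiedLineBundle.nonempty_iso_of_pullback_prodMap_of_isLocallyNoetherian`, `Q` locally Noetherian).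
(§4) Assembly with the three ★ predecessors.

* §0 `nonempty_iso_of_pullback_iso_iso` (private) — pull-back along an isomorphism reflects isomorphy.
* §1 `exists_rigidifiedLineBundle_transport` — the transported family `ℒ″ ≅ κ^*ℒ` on `A ×_S T′`, and «`κ^*` detects what
  `(1_B × c)^*` detects».
* §2 `autHom_comp_classify_eq_classify_comp_autHom` — equivariance of the classifying map.
* §3 `exists_classify_of_free_base_quotient` — existence of the classifying morphism over `Q` with its isomorphism.
* §4 **`exists_dualPair_fields_of_free_base_quotient`** — THE HEAD: `∃ 𝒫_B` with `HasRank 𝒫_B 1`, rigidified,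
  fibrewise `Pic⁰`, universal (`∃!`) over `Q`, and `(π ×_p π̂)^*𝒫_B ≅ 𝒫`; `⟨B̂, 𝒫_B, …⟩ : B.DualPair` in term mode.

Hypotheses beyond ★ `AbelianSchemeBaseQuotientDescent`: `Â` reduced and locally Noetherian (normalisation of the
linearisation), `Q` locally Noetherian (Stein for `B_T → T` over any test `T`), `p` locally of finite type (geometric
points lift), `B̂` separated (target of the descended morphism) — all satisfied by `M = A_{g,δ,NK} → M/Γ` over `ℚ`.

Mathlib searched (pin): `MorphismProperty.pullback_snd` (`IsAffineHom`, `Flat`, `Surjective`), `Flat` + `Surjective`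
+ `QuasiCompact` ⇒ `Epi`, `IsPullback.of_hasPullback`, `Scheme.Modules.pullbackComp/pullbackCongr/pullbackId` (used).

## References
* D. Mumford, J. Fogarty, F. Kirwan, *Geometric Invariant Theory*, 3rd ed. (1994), Ch. 6 §1 Cor. 6.8 (p. 118), §2
  (p. 121); Ch. 7 §3, remark after Thm. 7.9 and Lemma 7.11 (pp. 139–140). [MumfordFogartyKirwan1994]
* D. Mumford, *Abelian Varieties* (1970), §13 (Thm. p. 125 and its proof). [MumfordAV1970]
* J. S. Milne, *Abelian Varieties* (v2.00, 2008), I §8 pp. 36–37. [MilneAV2008]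
* A. Grothendieck, *SGA 1*, Exp. VIII Thm. 1.1, Cor. 7.8; Exp. V Prop. 2.6, Déf. 2.7. [SGA1]
* U. Görtz, T. Wedhorn, *Algebraic Geometry I*, 2nd ed. (2020), Prop. 4.16 (p. 101), Thm. 14.72. [GortzWedhorn2020]
-/

noncomputable section

universe u

open CategoryTheory Limits AlgebraicGeometry MonoidalCategory CartesianMonoidalCategory MonObj

namespace Literature.AlgebraicGeometry.AbelianSchemes.AbelianSchemeOver

open Literature.AlgebraicGeometry.RelativeSpec Literature.AlgebraicGeometry.RelativeSpec.ActionOver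
  Literature.AlgebraicGeometry.Modules Literature.AlgebraicGeometry.Motives
  Literature.AlgebraicGeometry.AbelianVarieties Literature.AlgebraicGeometry.Morphisms

set_option backward.isDefEq.respectTransparency false


/-! ### §0 Pull-back along an isomorphism reflects isomorphy of modules -/

/-- `e^* M ≅ e^* N` for an isomorphism of schemes `e` implies `M ≅ N`. [folklore] -/
private theorem nonempty_iso_of_pullback_iso_iso {X Y : Scheme.{u}} (e : X ⟶ Y) (e' : Y ⟶ X) (he : e' ≫ e = 𝟙 Y)
    {M N : Y.Modules} (h : Nonempty ((Scheme.Modules.pullback e).obj M ≅ (Scheme.Modules.pullback e).obj N)) :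
    Nonempty (M ≅ N) := by
  obtain ⟨i⟩ := h
  have strip : ∀ L : Y.Modules, (Scheme.Modules.pullback e').obj ((Scheme.Modules.pullback e).obj L) ≅ L := fun L =>
    (Scheme.Modules.pullbackComp e' e).app L ≪≫ (Scheme.Modules.pullbackCongr he).app L ≪≫
      (Scheme.Modules.pullbackId Y).app L
  exact ⟨(strip M).symm ≪≫ (Scheme.Modules.pullback e').mapIso i ≪≫ strip N⟩

variable {S Q : Scheme.{u}} {p : S ⟶ Q} {G : Type u} [Group G] [Fintype G] {ρ : ActionOver p G}
  (hq : ρ.IsGeometricQuotient p) [IsAffineHom p]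
  (hfree : ∀ (V : Q.Opens), IsAffineOpen V → ∀ g : G, g ≠ 1 →
    Ideal.span (Set.range fun s : Γ(S, p ⁻¹ᵁ V) ↦ ρ.act g V s - s) = ⊤)
  (A : AbelianSchemeOver S) (D : A.DualPair)
  (B : AbelianSchemeOver Q) {π : A.X.left ⟶ B.X.left} (ρA : ActionOver π G) (hAB : A.IsBaseChangeVia B p π)
  (hA : ∀ g : G, A.IsBaseChangeVia A (ρ.aut g).hom (ρA.aut g).hom)
  (Bh : AbelianSchemeOver Q) {πh : D.hat.X.left ⟶ Bh.X.left} (ρh : ActionOver πh G)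
  (hABh : D.hat.IsBaseChangeVia Bh p πh)
  (hAh : ∀ g : G, D.hat.IsBaseChangeVia D.hat (ρ.aut g).hom (ρh.aut g).hom)
  (P' : (B.prodLeft Bh).Modules)

/-! ### §1 Transport of a test family from `B ×_Q T` to `A ×_S T′` -/

omit [Fintype G] [IsAffineHom p] in
/-- **Transport of a rigidified `Pic⁰` family along `A ×_S T′ ≅ B ×_Q T′ → B ×_Q T`.**  For `f : T → Q`, `c : T′ → T`,
`f′ : T′ → S` with `f′ ≫ p = c ≫ f` and a rigidified fibrewise-`Pic⁰` line bundle `ℒ` on `B_T = B ×_Q T`, there is a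
rigidified fibrewise-`Pic⁰` line bundle `ℒ″` on `A_{T′} = A ×_S T′` with `ℒ″ ≅ κ^* ℒ`, `κ = π ×_p c : A ×_S T′ → B ×_Q T`;
moreover `κ^*` reflects isomorphy onto `(1_B × c)^*` (both through the isomorphism of group schemes `A ×_S T′ ≅ B ×_Q T′`
over `T′`, ★ `exists_iso_baseChange_prodMap`). [cite: MilneAV2008, I §8 pp. 36–37] [cite: MumfordAV1970, §13 (p. 125)]
[cite: GortzWedhorn2020, Prop. 4.16 (p. 101)] -/
theorem exists_rigidifiedLineBundle_transport {T T' : Scheme.{u}} (f : T ⟶ Q) (c : T' ⟶ T) (f' : T' ⟶ S)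
    (hc : f' ≫ p = c ≫ f) (ℒ : B.RigidifiedLineBundle f) (hℒ : ℒ.FibrewisePicZero) :
    ∃ ℒ'' : A.RigidifiedLineBundle f', ℒ''.FibrewisePicZero ∧
      Nonempty (ℒ''.L ≅ (Scheme.Modules.pullback (pullback.map A.X.hom f' B.X.hom f π c p hAB.fst.symm hc)).obj ℒ.L) ∧
      ∀ M N : (B.baseChange f).X.left.Modules,
        Nonempty ((Scheme.Modules.pullback (pullback.map A.X.hom f' B.X.hom f π c p hAB.fst.symm hc)).obj M ≅
          (Scheme.Modules.pullback (pullback.map A.X.hom f' B.X.hom f π c p hAB.fst.symm hc)).obj N) →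
        Nonempty ((Scheme.Modules.pullback (B.prodMap (c ≫ f) f c rfl)).obj M ≅
          (Scheme.Modules.pullback (B.prodMap (c ≫ f) f c rfl)).obj N) := by
  obtain ⟨E, hEm, hE⟩ := exists_iso_baseChange_prodMap A B hAB f c f' hc
  haveI := hEm
  -- `κ^* L ≅ E^* (1_B × c)^* L`
  have eκ : ∀ L : (B.baseChange f).X.left.Modules,
      (Scheme.Modules.pullback (pullback.map A.X.hom f' B.X.hom f π c p hAB.fst.symm hc)).obj L ≅
        (Scheme.Modules.pullback E.hom.left).obj ((Scheme.Modules.pullback (B.prodMap (c ≫ f) f c rfl)).obj L) :=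
    fun L => (Scheme.Modules.pullbackCongr hE.symm).app L ≪≫ ((Scheme.Modules.pullbackComp _ _).app L).symm
  -- the transported family
  let ℒc : B.RigidifiedLineBundle (c ≫ f) := ℒ.comapAlong c rfl
  have hℒc : ℒc.FibrewisePicZero := RigidifiedLineBundle.comapAlong_fibrewisePicZero hℒ c rfl
  let ℒ'' : A.RigidifiedLineBundle f' :=
    { L := (Scheme.Modules.pullback E.hom.left).obj ℒc.L
      hasRank_one := hasRank_pullback _ ℒc.hasRank_one
      rigid := ℒc.rigid.map fun r => (Scheme.Modules.pullbackComp _ _).app ℒc.L ≪≫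
        (Scheme.Modules.pullbackCongr (unitSection_comp_hom_left E)).app ℒc.L ≪≫ r }
  have hℒ'' : ℒ''.FibrewisePicZero := by
    intro Ω _ _ t
    have k1 := (isHomogeneous_pullback_iff_of_iso (fibreIsoOfIso E t) (ℒc.fibreModule t)).2 (hℒc Ω t)
    refine (isHomogeneous_iff_of_iso _ ?_).1 k1
    exact (Scheme.Modules.pullbackComp (AbelianVariety.Hom.toSchemeHom (fibreIsoOfIso E t).hom)
        (pullback.fst (B.baseChange (c ≫ f)).X.hom t)).app ℒc.L ≪≫
      (Scheme.Modules.pullbackCongr (fibreIsoOfIso_hom_toSchemeHom_fst E t)).app ℒc.L ≪≫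
      ((Scheme.Modules.pullbackComp (pullback.fst (A.baseChange f').X.hom t) E.hom.left).app ℒc.L).symm
  refine ⟨ℒ'', hℒ'', ⟨(eκ ℒ.L).symm⟩, fun M N ⟨i⟩ => ?_⟩
  exact nonempty_iso_of_pullback_iso_iso E.hom.left E.inv.left
    (by rw [← Over.comp_left, E.inv_hom_id, Over.id_left]) ⟨(eκ M).symm ≪≫ i ≪≫ eκ N⟩

/-! ### §2 The classifying map of a transported family is `G`-equivariant -/

omit [Fintype G] [IsAffineHom p] in
/-- **Equivariance of the classifying map.**  Let `σ : T′ → T′` cover `ρ(g₀)` on `S` (`σ ≫ f′ = f′ ≫ ρ(g₀)`) and fix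
`c : T′ → T` (`σ ≫ c = c`), and let `ℒ″` be a rigidified fibrewise-`Pic⁰` family on `A ×_S T′` isomorphic to `κ^* M`
for a module `M` on `B ×_Q T` (`κ = π ×_p c`).  If the Poincaré clause `(ρA(g₀) ×_{ρ(g₀)} ρÂ(g₀))^*𝒫 ≅ 𝒫` holds, then the
classifying map `g′ : T′ → Â` of `ℒ″` satisfies `σ ≫ g′ = g′ ≫ ρÂ(g₀)`: both sides classify the family `(1_A × σ)^*ℒ″`
over `f′ ≫ ρ(g₀)` — the left by restriction (★ `restrictSolutionIso`), the right because
`1_A × (g′ ≫ ρÂ(g₀)) = θ ≫ (1_A × g′) ≫ (ρA(g₀) × ρÂ(g₀))` with `θ = ρA(g₀)⁻¹ × 1` and `θ ≫ κ = (1_A × σ) ≫ κ` — so they agree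
by the uniqueness in `D.universal` (★ `DualPair.eq_of_nonempty_iso`). [cite: MumfordAV1970, §13 (p. 125)]
[cite: MilneAV2008, I §8 pp. 36–37] [cite: MumfordFogartyKirwan1994, Ch. 7 §3 Lemma 7.11 (p. 140)] -/
theorem autHom_comp_classify_eq_classify_comp_autHom
    (hP : ∀ g : G, Nonempty ((Scheme.Modules.pullback
      (pullback.map A.X.hom D.hat.X.hom A.X.hom D.hat.X.hom (ρA.aut g).hom (ρh.aut g).hom (ρ.aut g).hom
        (hA g).fst.symm (hAh g).fst.symm)).obj D.P ≅ D.P))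
    {T T' : Scheme.{u}} (f : T ⟶ Q) (c : T' ⟶ T) (f' : T' ⟶ S) (hc : f' ≫ p = c ≫ f) (g₀ : G) (σ : T' ⟶ T')
    (hσf : σ ≫ f' = f' ≫ (ρ.aut g₀).hom) (hσc : σ ≫ c = c) (M : (B.baseChange f).X.left.Modules)
    (ℒ'' : A.RigidifiedLineBundle f') (hℒ'' : ℒ''.FibrewisePicZero)
    (eκ : Nonempty (ℒ''.L ≅ (Scheme.Modules.pullback (pullback.map A.X.hom f' B.X.hom f π c p hAB.fst.symm hc)).obj M)) :
    σ ≫ D.classify f' ℒ'' hℒ'' = D.classify f' ℒ'' hℒ'' ≫ (ρh.aut g₀).hom := by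
  obtain ⟨eκ⟩ := eκ
  have hg' : D.classify f' ℒ'' hℒ'' ≫ D.hat.X.hom = f' := D.classify_comp_hom f' ℒ'' hℒ''
  obtain ⟨ecl⟩ := D.nonempty_pullbackP_classify_iso f' ℒ'' hℒ''
  -- the family `(1_A × σ)^* ℒ″` over `f′ ≫ ρ(g₀)`
  have hℒ₃ := RigidifiedLineBundle.comapAlong_fibrewisePicZero hℒ'' σ hσf
  have h₁ : (σ ≫ D.classify f' ℒ'' hℒ'') ≫ D.hat.X.hom = f' ≫ (ρ.aut g₀).hom := by rw [Category.assoc, hg', hσf]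
  have h₂ : (D.classify f' ℒ'' hℒ'' ≫ (ρh.aut g₀).hom) ≫ D.hat.X.hom = f' ≫ (ρ.aut g₀).hom := by
    rw [Category.assoc, (hAh g₀).fst, reassoc_of% hg']
  refine D.eq_of_nonempty_iso (f' ≫ (ρ.aut g₀).hom) (ℒ''.comapAlong σ hσf) hℒ₃ _ _ h₁ h₂
    ⟨A.restrictSolutionIso D.hat D.P σ hσf hg' ecl⟩ ?_
  -- (ii) the solution `g′ ≫ ρÂ(g₀)`
  have hinvS : (ρ.aut g₀).hom ≫ (ρ.aut g₀⁻¹).hom = 𝟙 S := by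
    rw [← ActionOver.aut_mul_hom, inv_mul_cancel, ActionOver.aut_one_hom]
  have hinvA : (ρA.aut g₀⁻¹).hom ≫ (ρA.aut g₀).hom = 𝟙 _ := by
    rw [← ActionOver.aut_mul_hom, mul_inv_cancel, ActionOver.aut_one_hom]
  have e₂ : (f' ≫ (ρ.aut g₀).hom) ≫ (ρ.aut g₀⁻¹).hom = 𝟙 T' ≫ f' := by
    rw [Category.assoc, hinvS, Category.comp_id, Category.id_comp]
  -- `θ = ρA(g₀)⁻¹ × 1 : A ×_{S, f′ ≫ ρ(g₀)} T′ → A ×_{S, f′} T′`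
  let θ : pullback A.X.hom (f' ≫ (ρ.aut g₀).hom) ⟶ pullback A.X.hom f' :=
    pullback.map A.X.hom (f' ≫ (ρ.aut g₀).hom) A.X.hom f' (ρA.aut g₀⁻¹).hom (𝟙 T') (ρ.aut g₀⁻¹).hom
      (hA g₀⁻¹).fst.symm e₂
  have hβ : A.baseChangeToProd D.hat (f' ≫ (ρ.aut g₀).hom) (D.classify f' ℒ'' hℒ'' ≫ (ρh.aut g₀).hom) h₂ =
      θ ≫ A.baseChangeToProd D.hat f' (D.classify f' ℒ'' hℒ'') hg' ≫
        pullback.map A.X.hom D.hat.X.hom A.X.hom D.hat.X.hom (ρA.aut g₀).hom (ρh.aut g₀).hom (ρ.aut g₀).hom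
          (hA g₀).fst.symm (hAh g₀).fst.symm := by
    apply pullback.hom_ext
    · rw [baseChangeToProd_fst, Category.assoc, Category.assoc, pullback.lift_fst, baseChangeToProd_fst_assoc,
        pullback.lift_fst_assoc, Category.assoc, hinvA, Category.comp_id]
    · rw [baseChangeToProd_snd, Category.assoc, Category.assoc, pullback.lift_snd, baseChangeToProd_snd_assoc,
        pullback.lift_snd_assoc, Category.comp_id]
  have hθκ : θ ≫ pullback.map A.X.hom f' B.X.hom f π c p hAB.fst.symm hc =
      A.prodMap (f' ≫ (ρ.aut g₀).hom) f' σ hσf ≫ pullback.map A.X.hom f' B.X.hom f π c p hAB.fst.symm hc := by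
    apply pullback.hom_ext
    · rw [Category.assoc, Category.assoc, pullback.lift_fst, pullback.lift_fst_assoc, prodMap_fst_assoc,
        Category.assoc, ρA.aut_comp]
    · rw [Category.assoc, Category.assoc, pullback.lift_snd, pullback.lift_snd_assoc, prodMap_snd_assoc,
        Category.comp_id, hσc]
  obtain ⟨eΘ⟩ := hP g₀
  refine ⟨(Scheme.Modules.pullbackCongr hβ).app D.P ≪≫
    ((Scheme.Modules.pullbackComp θ _).app D.P).symm ≪≫
    (Scheme.Modules.pullback θ).mapIso (((Scheme.Modules.pullbackComp _ _).app D.P).symm ≪≫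
      (Scheme.Modules.pullback _).mapIso eΘ ≪≫ ecl ≪≫ eκ) ≪≫
    (Scheme.Modules.pullbackComp θ _).app M ≪≫
    (Scheme.Modules.pullbackCongr hθκ).app M ≪≫
    ((Scheme.Modules.pullbackComp _ _).app M).symm ≪≫
    (Scheme.Modules.pullback _).mapIso eκ.symm⟩

/-! ### §3 Existence of the classifying morphism over `Q` -/

include hq hfree in
/-- **EXISTENCE HALF OF THE UNIVERSAL PROPERTY OF THE DESCENDED DUAL PAIR.**  In the SETTING (free affine quotient
`p : S → Q` of the base, `Q` locally Noetherian, `B̂` separated; `A`, `Â` the base changes of `B`, `B̂` along `p` as group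
schemes, with `G`-actions covering `ρ` by isomorphisms of group schemes and the Poincaré clause; `P′` a rigidified line
bundle on `B ×_Q B̂` with `(π ×_p π̂)^* P′ ≅ 𝒫`): every rigidified fibrewise-`Pic⁰` line bundle `ℒ` on `B_T`, `f : T → Q`,
is `(1_B × g)^* P′` for some `Q`-morphism `g : T → B̂`.  PROOF ([MumfordAV1970] §13 run on the cover `T ×_Q S → T`):
transport `ℒ` to `A ×_S T′`, `T′ = S ×_Q T` (§1); classify it by `D` (`g′ : T′ → Â`); `g′ ≫ π̂` is invariant under the
base-changed action (§2), hence descends along the geometric quotient `T′ → T` (★ `existsUnique_desc_baseChange_of_free`)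
to `g : T → B̂`; and `(1_B × g)^* P′ ≅ ℒ` holds after pull-back to `B ×_Q T′` (§1 + ★ `DualPairBaseQuotientDescentUnique`
§1), hence on `B_T` by fpqc descent of isomorphisms of RIGIDIFIED line bundles (★
`RigidifiedLineBundle.nonempty_iso_of_pullback_prodMap_of_isLocallyNoetherian`). [cite: MumfordAV1970, §13 (p. 125)]
[cite: MilneAV2008, I §8 pp. 36–37] [cite: MumfordFogartyKirwan1994, Ch. 7 §3, remark after Thm. 7.9 and Lemma 7.11 (pp. 139–140)]
[cite: SGA1, Exp. VIII Thm. 1.1 and Cor. 7.8] -/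
theorem exists_classify_of_free_base_quotient [IsLocallyNoetherian Q] [Bh.X.left.IsSeparated]
    (h1 : HasRank P' 1) (hrig : Nonempty ((Scheme.Modules.pullback (B.unitSlice Bh)).obj P' ≅ SheafOfModules.unit _))
    (eP : Nonempty ((Scheme.Modules.pullback
      (pullback.map A.X.hom D.hat.X.hom B.X.hom Bh.X.hom π πh p hAB.fst.symm hABh.fst.symm)).obj P' ≅ D.P))
    (hP : ∀ g : G, Nonempty ((Scheme.Modules.pullback
      (pullback.map A.X.hom D.hat.X.hom A.X.hom D.hat.X.hom (ρA.aut g).hom (ρh.aut g).hom (ρ.aut g).hom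
        (hA g).fst.symm (hAh g).fst.symm)).obj D.P ≅ D.P))
    {T : Scheme.{u}} (f : T ⟶ Q) (ℒ : B.RigidifiedLineBundle f) (hℒ : ℒ.FibrewisePicZero) :
    ∃ g : {g : T ⟶ Bh.X.left // g ≫ Bh.X.hom = f},
      Nonempty ((Scheme.Modules.pullback (B.baseChangeToProd Bh f g.1 g.2)).obj P' ≅ ℒ.L) := by
  -- the cover `T′ = S ×_Q T → T`
  have hc : pullback.fst p f ≫ p = pullback.snd p f ≫ f := pullback.condition
  haveI : Surjective p := ⟨hq.surjective⟩
  haveI : Flat p := hq.flat_of_free hfree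
  haveI : IsAffineHom (pullback.snd p f) := MorphismProperty.pullback_snd _ _ inferInstance
  haveI : Flat (pullback.snd p f) := MorphismProperty.pullback_snd _ _ inferInstance
  haveI : Surjective (pullback.snd p f) := MorphismProperty.pullback_snd _ _ inferInstance
  haveI : Epi (pullback.snd p f) := inferInstance
  -- §1: transport the test family to `A ×_S T′` and classify it by `D`
  obtain ⟨ℒ'', hℒ'', ⟨eκ⟩, htr⟩ :=
    exists_rigidifiedLineBundle_transport A B hAB f (pullback.snd p f) (pullback.fst p f) hc ℒ hℒ
  have hg' : D.classify _ ℒ'' hℒ'' ≫ D.hat.X.hom = pullback.fst p f := D.classify_comp_hom _ ℒ'' hℒ''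
  obtain ⟨ecl⟩ := D.nonempty_pullbackP_classify_iso _ ℒ'' hℒ''
  -- §2: `g′ ≫ π̂` is invariant under the base-changed action, hence descends to `T`
  have hinv : ∀ g₀ : G, ((ρ.baseChange f).aut g₀).hom ≫ (D.classify _ ℒ'' hℒ'' ≫ πh) = D.classify _ ℒ'' hℒ'' ≫ πh :=
    fun g₀ => by
    rw [← Category.assoc, autHom_comp_classify_eq_classify_comp_autHom A D B ρA hAB hA Bh ρh hAh hP f
      (pullback.snd p f) (pullback.fst p f) hc g₀ _ (ActionOver.baseChange_aut_hom_fst ρ f g₀)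
      (ActionOver.baseChange_aut_hom_snd ρ f g₀) ℒ.L ℒ'' hℒ'' ⟨eκ⟩, Category.assoc, ρh.aut_comp]
  obtain ⟨g, hg, -⟩ := hq.existsUnique_desc_baseChange_of_free hfree (IsPullback.of_hasPullback p f)
    (ρ.baseChange f) (ActionOver.baseChange_aut_hom_fst ρ f) _ hinv
  have hgf : g ≫ Bh.X.hom = f := by
    rw [← cancel_epi (pullback.snd p f), reassoc_of% hg, hABh.fst, reassoc_of% hg', hc]
  -- §3: the isomorphism `(1_B × g)^* P′ ≅ ℒ`, first on `B ×_Q T′`, then descended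
  let ℒB : B.RigidifiedLineBundle Bh.X.hom :=
    { L := P'
      hasRank_one := h1
      rigid := ⟨(Scheme.Modules.pullbackCongr (B.unitSection_baseChange_eq_unitSlice Bh)).app P' ≪≫ hrig.some⟩ }
  obtain ⟨j⟩ := nonempty_pullbackP_iso_pullback_pullback_baseChangeToProd A D B hAB Bh hABh P' eP f
    (pullback.snd p f) (pullback.fst p f) hc g hgf _ hg' hg.symm
  obtain ⟨i⟩ := RigidifiedLineBundle.nonempty_iso_of_pullback_prodMap_of_isLocallyNoetherian f (pullback.snd p f)
    (ℒB.comapAlong g hgf) ℒ (htr _ _ ⟨j.symm ≪≫ ecl ≪≫ eκ⟩)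
  exact ⟨⟨g, hgf⟩, ⟨i⟩⟩

/-! ### §4 Assembly: the dual pair of `B`, field by field -/

include hq hfree in
/-- **THE DUAL PAIR DESCENDS ALONG A FREE FINITE QUOTIENT OF THE BASE** ([MumfordFogartyKirwan1994] Ch. 7 §3, the
level-lowering step `A_{g,δ,N} = A_{g,δ,NK}/Γ`: «the universal family descends along `M → M/Γ`», dual-pair half).
In the SETTING of ★ `AbelianSchemeBaseQuotientDescent` doubled — `p : S → Q = S/G` a free affine geometric quotient,
locally of finite type, `Q` locally Noetherian; `A/S` with a dual pair `D = (Â, 𝒫)`, `Â` reduced and locally Noetherian;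
`B`, `B̂` abelian schemes over `Q` (`B̂` separated) with `π : A → B`, `π̂ : Â → B̂` exhibiting `A`, `Â` as base changes
along `p` as group schemes; `G`-actions `ρA`, `ρÂ` over `π`, `π̂` covering `ρ` by isomorphisms of group schemes; and
the POINCARÉ CLAUSE `(ρA(g) ×_{ρ(g)} ρÂ(g))^*𝒫 ≅ 𝒫` for all `g` (no cocycle asked) — there is a module `𝒫_B` on
`B ×_Q B̂` satisfying ALL FOUR property fields of ★ `DualPair` for `(B̂, 𝒫_B)`: a line bundle (`HasRank 𝒫_B 1`),
rigidified along `ε_B × 1_{B̂}`, fibrewise in `Pic⁰` over `B̂`, and UNIVERSAL over `Q` (`∃!` classifying morphism for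
every rigidified fibrewise-`Pic⁰` family on every `B_T`), TOGETHER WITH `(π ×_p π̂)^* 𝒫_B ≅ 𝒫` — the Poincaré clause
of ★ `PolarizedAbelianSchemeWithLevel.IsBaseChangeVia` along `(π, π̂, p)`.  So `⟨B̂, 𝒫_B, …⟩ : B.DualPair` (term mode)
is a dual pair of `B` of which `D` is the base change along `p`.  (★ `PoincareBaseQuotientDescent`: the sheaf; ★
`PoincareBaseQuotientDescentPicZero`: clause (a); ★ `DualPairBaseQuotientDescentUnique` + §3: universality.)
[cite: MumfordFogartyKirwan1994, Ch. 7 §3, remark after Thm. 7.9 and Lemma 7.11 (pp. 139–140)]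
[cite: MumfordFogartyKirwan1994, Ch. 6 §1 Cor. 6.8 (p. 118) and §2 (p. 121)] [cite: MumfordAV1970, §13 (p. 125)]
[cite: MilneAV2008, I §8 pp. 36–37] [cite: SGA1, Exp. VIII Cor. 7.8] -/
theorem exists_dualPair_fields_of_free_base_quotient [IsReduced D.hat.X.left] [IsLocallyNoetherian D.hat.X.left]
    [IsLocallyNoetherian Q] [LocallyOfFiniteType p] [Bh.X.left.IsSeparated]
    (hP : ∀ g : G, Nonempty ((Scheme.Modules.pullback
      (pullback.map A.X.hom D.hat.X.hom A.X.hom D.hat.X.hom (ρA.aut g).hom (ρh.aut g).hom (ρ.aut g).hom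
        (hA g).fst.symm (hAh g).fst.symm)).obj D.P ≅ D.P)) :
    ∃ PB : (B.prodLeft Bh).Modules, HasRank PB 1 ∧
      Nonempty ((Scheme.Modules.pullback (B.unitSlice Bh)).obj PB ≅ SheafOfModules.unit _) ∧
      (∀ (Ω : Type u) [Field Ω] [IsAlgClosed Ω] (b : Spec (.of Ω) ⟶ Bh.X.left),
        IsHomogeneous (B.fibre (b ≫ Bh.X.hom)).toAbelianVariety
          ((Scheme.Modules.pullback (B.fibreSlice Bh b)).obj PB)) ∧
      (∀ {T : Scheme.{u}} (f : T ⟶ Q) (ℒ : B.RigidifiedLineBundle f), ℒ.FibrewisePicZero →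
        ∃! g : {g : T ⟶ Bh.X.left // g ≫ Bh.X.hom = f},
          Nonempty ((Scheme.Modules.pullback (B.baseChangeToProd Bh f g.1 g.2)).obj PB ≅ ℒ.L)) ∧
      Nonempty ((Scheme.Modules.pullback
        (pullback.map A.X.hom D.hat.X.hom B.X.hom Bh.X.hom π πh p hAB.fst.symm hABh.fst.symm)).obj PB ≅ D.P) := by
  haveI : Surjective p := ⟨hq.surjective⟩
  haveI : Flat p := hq.flat_of_free hfree
  obtain ⟨PB, h1, hrig, eP⟩ :=
    exists_rigidified_poincare_desc_of_free_base_quotient hq hfree A D B ρA hAB hA Bh ρh hABh hAh hP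
  refine ⟨PB, h1, hrig, fun Ω _ _ b => ?_, fun f ℒ hℒ => ?_, eP⟩
  · exact isHomogeneous_fibreSlice_of_pullback_prodQuotientMap_iso A D B hAB Bh hABh PB h1 hrig eP Ω b
  · obtain ⟨g, ⟨e⟩⟩ := exists_classify_of_free_base_quotient hq hfree A D B ρA hAB hA Bh ρh hABh hAh PB h1 hrig eP hP
      f ℒ hℒ
    exact ⟨g, ⟨e⟩, fun g' ⟨e'⟩ => Subtype.ext
      (eq_of_pullback_baseChangeToProd_iso_of_base_quotient A D B hAB Bh hABh PB eP f g'.1 g.1 g'.2 g.2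
        ⟨e' ≪≫ e.symm⟩)⟩

end Literature.AlgebraicGeometry.AbelianSchemes.AbelianSchemeOver

end
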